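import Summits.NavierStokesRegularity.NavierStokesRegularity.Theorems.HeredityFromTwoT.Negative.HeredityFromTwoTFalseOfNoSwirlRungT
import Summits.NavierStokesRegularity.FluidComputer.PalasekTowerGermHostFreeRunStageAt
import Summits.NavierStokesRegularity.FluidComputer.PalasekTowerGermHostDilation

/-!
# The STERILE companion-free germ door IN ARBITRARY UNITS: one free kit run of an axisymmetric swirl-free slice that fills
# the strict slot at release and meets the first window's letter gives `NoSwirlRungGAt R 1`; at `tuned`,
# `EpisodeBaseT ∧ ¬ (HeredityAtOneT ∧ HeredityFromTwoT)` — the kernel form of the STERILE-DOOR test's label (A⁺)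

Cell `ns-blowup`, seat `ns-blowup-ecbridge-3` (g12; D-0074 GROUP C «BRIDGE SUPPORT», lineage `host_preparation`).
Route `PalasekTowerBreakdown` (rev 19): crux stmt-NavierStokesRegularity-20303 `EpisodeBaseT`, pair 20304/20305. LABEL: E–C
typing (KERNEL: theorems only; `--supports` stmt-NavierStokesRegularity-20303). WHAT THIS IS NOT: not Navier–Stokes
evidence — no slice, run, stage or design is exhibited; the route decls appear only as conclusions of conditionals whose
hypothesis is ONE free run in kit units; nothing registers, no census number moves.

## The dictionary (PREREG-0b label (A⁺), LEAD a1 (a1-ii); reader `door_scan5.py`)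

Kit viscosity `ν' > 0`, speed conversion `κ > 0` (register speed = `κ ×` kit speed), `g = κν'`, release time `t_a`, centre
`x₀` ON THE AXIS (`x₀ 0 = x₀ 1 = 0`), window `T = κ²ν'·wfirstAt R`. Hypotheses on the kit run `(v, q)` (free, classical,
finite energy on `[t_a, t_a + T]`): the release slice `v t_a` is supported in `B̄(x₀, ρ)`, axisymmetric swirl-free, with
(ceiling) `κ‖v t_a‖ ≤ Y₀(R)` everywhere and `= Y₀(R)` attained in the ball, (F6₀) `A₀(R) ≤ κg‖D(v t_a)‖` somewhere in the
ball, (F7₀) a loop in a ball of radius `g/N₀(R)` of speed `≤ 8πg/N₀(R)` with `ν' N₀(R)^{β−2} ≤ ∮ v t_a`, (ANCHOR)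
`0 < ⟪v t_a x, accel ν' (v t_a) x⟫` wherever `κ‖v t_a x‖ = Y₀(R)`; on the window the cap `κ‖v‖ ≤ (5/3)Y₁(R) − η`; at
`t_a + T` in the ball: `Y₁(R) + η ≤ κ‖v‖`, `A₁(R) + η ≤ κg‖Dv‖`, a loop in a ball of radius `g/N₁(R)` of speed
`≤ 8πg/N₁(R)` with `ν'(N₁(R)^{β−2} + η) ≤ ∮v`. Conclusion: `NoSwirlRungGAt R 1`
(`palasekTowerBreakdown_noSwirlRungGAt_one_of_scaled_sterile_freeRun`, any `R.BoxNumerics`); at `tuned`: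
`EpisodeBaseT ∧ ¬(HeredityAtOneT ∧ HeredityFromTwoT)` (`…_of_scaled_sterile_freeRun_tuned`). In the cell's kit
normalisation (`Y₀ = A₀ = 1`, `ν' = N₀^{2−β}`, `κ = Y₀(tuned)/m`): window `169.85/m²`; level-0 clauses at `t_a`: F6₀
`G(t_a) ≥ m²`, F7₀ disc radius `1/m` with circulation `≥ 1`, dM/dt-at-argmax `> 0` as the MODEL proxy of the anchor; level-1
clauses as READING 2 (`2.0705 m`, `3.482 m²`, `1.231` in radius `0.5946/m`, cap `3.45 m`). Proof = the rescaling of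
`PalasekTowerMechanismDoorAtScaled` (same bookkeeping) + `Germ.levelZeroDataAt_smul_comp_affine` (the strict slot incl. the
NONLOCAL anchor transports: `accel 1 U = κ²g • accel ν' u ∘ A`) + `Germ.isAxisymmetric/hasNoSwirl_smul_comp_onAxis_affine` +
the sterile germ door (as in `palasekTowerBreakdown_noSwirlRungGAt_one_of_sterile_freeRun`, p558004; inlined here to keep the import chain short).

References: J. Leray, Acta Math. 63 (1934) §20 [cite: Leray1934, §20]; S. Palasek, arXiv:2605.13827 §4
[cite: Palasek2026ElementaryModel, §4]; P. G. Lemarié-Rieusset (2016) Thm 10.4 [cite: LemarieRieusset2016, Thm 10.4 (p. 285)].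
-/

noncomputable section

-- `Summit.<Summit>.<Problem>` is the tree's mandated summit-side namespace (CONVENTIONS §2); for this
-- single-conjunct summit the two coincide, so the duplicate is deliberate.
set_option linter.dupNamespace false

namespace Summit.NavierStokesRegularity.NavierStokesRegularity.Theorems

open Set Function MeasureTheory Metric
open scoped ENNReal ContDiff RealInnerProductSpace
open Summit.NavierStokesRegularity.NavierStokesRegularity.Theses
open Summit.NavierStokesRegularity.FluidComputer.PalasekTowerClayBridge
open Summit.NavierStokesRegularity.FluidComputer.PalasekTowerClayBridge.StrainDoor
open Summit.NavierStokesRegularity.FluidComputer.PalasekTowerClayBridge.Germ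
open Summit.NavierStokesRegularity.HeredityFromTwoTNoSwirl
open Literature.Analysis Literature.Analysis.FluidPDE

/-- **THE STERILE GERM DOOR IN ARBITRARY UNITS** (statement in the module docstring): one free kit run of an axisymmetric
swirl-free slice filling the strict slot at release and meeting the first window's letter ⟹ `NoSwirlRungGAt R 1`.
[cite: Palasek2026ElementaryModel, §4] [cite: Leray1934, §20] -/
theorem palasekTowerBreakdown_noSwirlRungGAt_one_of_scaled_sterile_freeRun {R : TowerRates} {c₃ r : ℝ}
    (hR : R.BoxNumerics c₃ r)
    {ν' κ : ℝ} (hν' : 0 < ν') (hκ : 0 < κ) (t_a : ℝ) {x₀ : EuclideanSpace ℝ (Fin 3)} (hx0 : x₀ 0 = 0) (hx1 : x₀ 1 = 0)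
    {T : ℝ}
    (hT : T = κ ^ 2 * ν' * Host.wfirstAt R)
    {v : ℝ → EuclideanSpace ℝ (Fin 3) → EuclideanSpace ℝ (Fin 3)} {q : ℝ → EuclideanSpace ℝ (Fin 3) → ℝ}
    (hv : IsClassicalNSSolutionOn (Icc t_a (t_a + T)) ν' 0 v q)
    {ρ : ℝ} (hsupp : tsupport (v t_a) ⊆ closedBall x₀ ρ)
    (hax : IsAxisymmetric (v t_a)) (hsw : HasNoSwirl (v t_a))
    (hceil : ∀ x, κ * ‖v t_a x‖ ≤ R.Y 0) (hfloor : ∃ x, ‖x - x₀‖ ≤ ρ ∧ R.Y 0 ≤ κ * ‖v t_a x‖)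
    (hstrain₀ : ∃ x, ‖x - x₀‖ ≤ ρ ∧ R.A 0 ≤ κ * (κ * ν') * ‖fderiv ℝ (v t_a) x‖)
    (hcore₀ : ∃ (x : EuclideanSpace ℝ (Fin 3)) (c : ℝ → EuclideanSpace ℝ (Fin 3)),
      ‖x - x₀‖ ≤ ρ ∧ ContDiff ℝ 1 c ∧ c 0 = c 1 ∧
      (∀ s ∈ Icc (0 : ℝ) 1, c s ∈ closedBall x (κ * ν' / R.N 0)) ∧
      (∀ s ∈ Icc (0 : ℝ) 1, ‖deriv c s‖ ≤ 8 * Real.pi * (κ * ν') / R.N 0) ∧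
      ν' * R.N 0 ^ (R.β - 2) ≤ circulation (v t_a) c)
    (hanchor : ∀ x, κ * ‖v t_a x‖ = R.Y 0 → 0 < ⟪v t_a x, accel ν' (v t_a) x⟫)
    (hE : ∃ C : ℝ≥0∞, C < ⊤ ∧ ∀ t ∈ Icc t_a (t_a + T), ∫⁻ x, ‖v t x‖ₑ ^ 2 ≤ C)
    {η : ℝ} (hη : 0 < η)
    (hcap : ∀ t ∈ Icc t_a (t_a + T), ∀ x, κ * ‖v t x‖ ≤ 5 / 3 * R.Y 1 - η)
    (hspeed : ∃ x, ‖x - x₀‖ ≤ ρ ∧ R.Y 1 + η ≤ κ * ‖v (t_a + T) x‖)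
    (hstrain : ∃ x, ‖x - x₀‖ ≤ ρ ∧ R.A 1 + η ≤ κ ^ 2 * ν' * ‖fderiv ℝ (v (t_a + T)) x‖)
    (hcore : ∃ (x : EuclideanSpace ℝ (Fin 3)) (c : ℝ → EuclideanSpace ℝ (Fin 3)),
      ‖x - x₀‖ ≤ ρ ∧ ContDiff ℝ 1 c ∧ c 0 = c 1 ∧
      (∀ s ∈ Icc (0 : ℝ) 1, c s ∈ closedBall x (κ * ν' / R.N 1)) ∧
      (∀ s ∈ Icc (0 : ℝ) 1, ‖deriv c s‖ ≤ 8 * Real.pi * (κ * ν') / R.N 1) ∧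
      ν' * (R.N 1 ^ (R.β - 2) + η) ≤ circulation (v (t_a + T)) c) :
    NoSwirlRungGAt R 1 := by
  -- the parameters of the rescaling: dilation `g = κ ν'`, clock rate `b = κ g = κ² ν'`, clock origin `t₀ = t_a − b`
  set g : ℝ := κ * ν' with hg
  have hgpos : 0 < g := mul_pos hκ hν'
  have hg0 : g ≠ 0 := hgpos.ne'
  set b : ℝ := κ * g with hb
  have hbpos : 0 < b := mul_pos hκ hgpos
  have hb2 : κ ^ 2 * ν' = b := by rw [hb, hg]; ring
  have hTb : T = b * Host.wfirstAt R := by rw [hT, hb2]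
  set t₀ : ℝ := t_a - b with ht₀
  have hN1 : 0 < R.N 1 := R.N_pos 1
  -- the clock: `t₀ + b · 1 = t_a`, `t₀ + b · τfirstAt R = t_a + T`, `[1, τfirstAt R] ↦ [t_a, t_a + T]`
  have hclock1 : t₀ + b * 1 = t_a := by rw [ht₀]; ring
  have hclockT : t₀ + b * Host.τfirstAt R = t_a + T := by rw [Host.τfirstAt_eq, hTb, ht₀]; ring
  have hS : (fun r => t₀ + b * r) ⁻¹' Icc t_a (t_a + T) = Icc 1 (Host.τfirstAt R) := by
    rw [Host.τfirstAt_eq, hTb, ht₀]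
    exact preimage_clock_Icc hbpos
  have hmem : ∀ {s : ℝ}, s ∈ Icc 1 (Host.τfirstAt R) → t₀ + b * s ∈ Icc t_a (t_a + T) := by
    intro s hs
    have h := clock_mem_Icc (t_a := t_a) (w := Host.wfirstAt R) hbpos (s := s)
      (by rw [← Host.τfirstAt_eq]; exact hs)
    rw [hTb, ht₀]
    exact h
  have h1mem : (1 : ℝ) ∈ Icc 1 (Host.τfirstAt R) := ⟨le_rfl, (Host.one_lt_τfirstAt R).le⟩
  have hτmem : Host.τfirstAt R ∈ Icc 1 (Host.τfirstAt R) := ⟨(Host.one_lt_τfirstAt R).le, le_rfl⟩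
  have hTnn : 0 ≤ T := by rw [hTb]; exact mul_nonneg hbpos.le (Host.wfirstAt_pos R).le
  have ht_a : t_a ∈ Icc t_a (t_a + T) := ⟨le_rfl, le_add_of_nonneg_right hTnn⟩
  -- the rescaled classical free run with viscosity `1` on `[1, τfirstAt R]`
  have key : IsClassicalNSSolutionOn (Icc 1 (Host.τfirstAt R)) 1 0 (κ • stPull b g t₀ x₀ v)
      (κ ^ 2 • stPull b g t₀ x₀ q) := by
    have h := hv.stRescale hκ hgpos hb t₀ x₀
    rw [hS, smul_stPull_zero, show κ * ν' / g = 1 from by rw [hg]; exact div_self hg0] at h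
    exact h
  -- the datum `W = κ v(t_a, x₀ + g ·)`: smooth, divergence free, supported in `B̄(0, ρ/g)`, speed `< Y₀`
  have hW1 : (κ • stPull b g t₀ x₀ v) 1 = fun y => κ • v t_a (x₀ + g • y) := by
    funext y
    rw [smul_stPull_apply, hclock1]
  -- energy on the register window
  have hE' : ∃ C : ℝ≥0∞, C < ⊤ ∧ ∀ s ∈ Icc (1 : ℝ) (Host.τfirstAt R),
      ∫⁻ y, ‖(κ • stPull b g t₀ x₀ v) s y‖ₑ ^ 2 ≤ C := by
    obtain ⟨C, hC, hCb⟩ := hE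
    refine ⟨‖κ‖ₑ ^ 2 * (ENNReal.ofReal (g ^ Module.finrank ℝ (EuclideanSpace ℝ (Fin 3)))⁻¹ * C), ?_, ?_⟩
    · exact ENNReal.mul_lt_top (by simp) (ENNReal.mul_lt_top ENNReal.ofReal_lt_top hC)
    · intro s hs
      exact lintegral_enorm_sq_smul_stPull_le_of_le hgpos b t₀ x₀ v s (hCb _ (hmem hs))
  -- cap on the register window
  have hcap' : ∀ s ∈ Icc (1 : ℝ) (Host.τfirstAt R), ∀ y,
      ‖(κ • stPull b g t₀ x₀ v) s y‖ ≤ 5 / 3 * R.Y 1 - η := by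
    intro s hs y
    rw [smul_stPull_apply, norm_smul, Real.norm_of_nonneg hκ.le]
    exact hcap _ (hmem hs) _
  -- the readout slice at `τfirstAt R` is `κ v(t_a + T, x₀ + g ·)`
  have hWT : (κ • stPull b g t₀ x₀ v) (Host.τfirstAt R) = fun y => κ • v (t_a + T) (x₀ + g • y) := by
    funext y
    rw [smul_stPull_apply, hclockT]
  -- the pulled-back readout point `y = g⁻¹ (x − x₀)` of a kit point `x ∈ B̄(x₀, ρ)`
  have hpt : ∀ {x : EuclideanSpace ℝ (Fin 3)}, ‖x - x₀‖ ≤ ρ →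
      ‖g⁻¹ • (x - x₀)‖ ≤ ρ / g ∧ x₀ + g • (g⁻¹ • (x - x₀)) = x := by
    intro x hx
    refine ⟨?_, ?_⟩
    · rw [norm_smul, Real.norm_of_nonneg (inv_nonneg.2 hgpos.le), inv_mul_eq_div]
      exact div_le_div_of_nonneg_right hx hgpos.le
    · rw [smul_smul, mul_inv_cancel₀ hg0, one_smul, add_sub_cancel]
  -- speed face
  have hspeed' : ∃ y, ‖y‖ ≤ ρ / g ∧ R.Y 1 + η ≤ ‖(κ • stPull b g t₀ x₀ v) (Host.τfirstAt R) y‖ := by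
    obtain ⟨x, hx, hfl⟩ := hspeed
    refine ⟨g⁻¹ • (x - x₀), (hpt hx).1, ?_⟩
    rw [hWT]
    dsimp only
    rw [(hpt hx).2, norm_smul, Real.norm_of_nonneg hκ.le]
    exact hfl
  -- gradient face
  have hstrain' : ∃ y, ‖y‖ ≤ ρ / g ∧
      R.A 1 + η ≤ ‖fderiv ℝ ((κ • stPull b g t₀ x₀ v) (Host.τfirstAt R)) y‖ := by
    obtain ⟨x, hx, hfl⟩ := hstrain
    refine ⟨g⁻¹ • (x - x₀), (hpt hx).1, ?_⟩
    have hdiff : Differentiable ℝ (v (t₀ + b * Host.τfirstAt R)) := by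
      rw [hclockT]
      exact (hv.contDiff_velocity (hclockT ▸ hmem hτmem)).differentiable (by simp)
    have hd : DifferentiableAt ℝ (stPull b g t₀ x₀ v (Host.τfirstAt R)) (g⁻¹ • (x - x₀)) :=
      differentiable_stPull_slice hdiff _
    have hfd : fderiv ℝ ((κ • stPull b g t₀ x₀ v) (Host.τfirstAt R)) (g⁻¹ • (x - x₀)) =
        κ • (g • fderiv ℝ (v (t_a + T)) x) := by
      rw [show (κ • stPull b g t₀ x₀ v) (Host.τfirstAt R) = κ • (stPull b g t₀ x₀ v (Host.τfirstAt R)) from rfl,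
        fderiv_const_smul hd, fderiv_stPull, hclockT, (hpt hx).2]
    rw [hfd, norm_smul, norm_smul, Real.norm_of_nonneg hκ.le, Real.norm_of_nonneg hgpos.le, ← mul_assoc,
      show κ * g = κ ^ 2 * ν' from by rw [hg]; ring]
    exact hfl
  -- core face: the pulled-back loop `s ↦ g⁻¹ (c s − x₀)`
  have hcore' : ∃ (y : EuclideanSpace ℝ (Fin 3)) (γ : ℝ → EuclideanSpace ℝ (Fin 3)),
      ‖y‖ ≤ ρ / g ∧ ContDiff ℝ 1 γ ∧ γ 0 = γ 1 ∧
      (∀ s ∈ Icc (0 : ℝ) 1, γ s ∈ closedBall y (1 / R.N 1)) ∧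
      (∀ s ∈ Icc (0 : ℝ) 1, ‖deriv γ s‖ ≤ 8 * Real.pi / R.N 1) ∧
      R.N 1 ^ (R.β - 2) + η ≤ circulation ((κ • stPull b g t₀ x₀ v) (Host.τfirstAt R)) γ := by
    obtain ⟨x, c, hx, hc1, hc01, hball, hspd, hcirc⟩ := hcore
    refine ⟨g⁻¹ • (x - x₀), fun s => g⁻¹ • (c s - x₀), (hpt hx).1, ?_, ?_, ?_, ?_, ?_⟩
    · exact (hc1.sub contDiff_const).const_smul _
    · simp only [hc01]
    · intro s hs
      have h := hball s hs
      rw [mem_closedBall, dist_eq_norm] at h ⊢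
      rw [← smul_sub, sub_sub_sub_cancel_right, norm_smul, Real.norm_of_nonneg (inv_nonneg.2 hgpos.le)]
      calc g⁻¹ * ‖c s - x‖ ≤ g⁻¹ * (κ * ν' / R.N 1) := mul_le_mul_of_nonneg_left h (inv_nonneg.2 hgpos.le)
        _ = 1 / R.N 1 := by rw [← hg]; field_simp
    · intro s hs
      have h := hspd s hs
      rw [deriv_fun_const_smul_field, deriv_sub_const, norm_smul, Real.norm_of_nonneg (inv_nonneg.2 hgpos.le)]
      calc g⁻¹ * ‖deriv c s‖ ≤ g⁻¹ * (8 * Real.pi * (κ * ν') / R.N 1) :=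
            mul_le_mul_of_nonneg_left h (inv_nonneg.2 hgpos.le)
        _ = 8 * Real.pi / R.N 1 := by rw [← hg]; field_simp
    · rw [hWT, circulation_smul_affine_pullback hg0 x₀ (v (t_a + T)) c,
        show κ / g = ν'⁻¹ from by rw [hg, ← div_div, div_self hκ.ne', one_div]]
      rw [inv_mul_eq_div, le_div_iff₀ hν', mul_comm]
      exact hcirc
  -- the strict slot at `R` filled by the rescaled slice, and its sterility
  have hLZ : Germ.LevelZeroDataAt R (fun y => κ • v t_a (x₀ + g • y)) (ρ / g) :=
    Germ.levelZeroDataAt_smul_comp_affine x₀ hν' hκ (hv.contDiff_velocity ht_a) (hv.divFree t_a ht_a) hsupp hceil hfloor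
      hstrain₀ hcore₀ hanchor
  have hax' : IsAxisymmetric (fun y => κ • v t_a (x₀ + g • y)) := Germ.isAxisymmetric_smul_comp_onAxis_affine hax hx0 hx1 κ g
  have hsw' : HasNoSwirl (fun y => κ • v t_a (x₀ + g • y)) := Germ.hasNoSwirl_smul_comp_onAxis_affine hsw hx0 hx1 κ hg0
  -- close by the sterile germ door (as in `palasekTowerBreakdown_noSwirlRungGAt_one_of_sterile_freeRun`, inlined)
  obtain ⟨σ₀, ε, d, ⟨s⟩⟩ := hLZ.exists_lineGerm_stageOne_of_freeRun hR key hW1 hE' hη hcap' hspeed' hstrain' hcore'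
  obtain ⟨hrig, hqu, hpins, -⟩ := d.schedule_facts hR
  exact ⟨d.schedule hR, hpins, hrig, hqu, d.schedule_axisym_noSwirl hR hax' hsw', ⟨s⟩⟩

/-- **At `tuned`: `EpisodeBaseT ∧ ¬(HeredityAtOneT ∧ HeredityFromTwoT)` from ONE free kit run of a sterile slice meeting the
(A⁺) clauses** (K201 by name). [cite: LemarieRieusset2016, Thm 10.4 (p. 285)] [cite: Palasek2026ElementaryModel, §4] -/
theorem palasekTowerBreakdown_episodeBaseT_and_not_heredity_pair_of_scaled_sterile_freeRun
    {ν' κ : ℝ} (hν' : 0 < ν') (hκ : 0 < κ) (t_a : ℝ) {x₀ : EuclideanSpace ℝ (Fin 3)} (hx0 : x₀ 0 = 0) (hx1 : x₀ 1 = 0)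
    {T : ℝ} (hT : T = κ ^ 2 * ν' * Host.wfirstAt TowerRates.tuned)
    {v : ℝ → EuclideanSpace ℝ (Fin 3) → EuclideanSpace ℝ (Fin 3)} {q : ℝ → EuclideanSpace ℝ (Fin 3) → ℝ}
    (hv : IsClassicalNSSolutionOn (Icc t_a (t_a + T)) ν' 0 v q)
    {ρ : ℝ} (hsupp : tsupport (v t_a) ⊆ closedBall x₀ ρ)
    (hax : IsAxisymmetric (v t_a)) (hsw : HasNoSwirl (v t_a))
    (hceil : ∀ x, κ * ‖v t_a x‖ ≤ TowerRates.tuned.Y 0) (hfloor : ∃ x, ‖x - x₀‖ ≤ ρ ∧ TowerRates.tuned.Y 0 ≤ κ * ‖v t_a x‖)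
    (hstrain₀ : ∃ x, ‖x - x₀‖ ≤ ρ ∧ TowerRates.tuned.A 0 ≤ κ * (κ * ν') * ‖fderiv ℝ (v t_a) x‖)
    (hcore₀ : ∃ (x : EuclideanSpace ℝ (Fin 3)) (c : ℝ → EuclideanSpace ℝ (Fin 3)),
      ‖x - x₀‖ ≤ ρ ∧ ContDiff ℝ 1 c ∧ c 0 = c 1 ∧
      (∀ s ∈ Icc (0 : ℝ) 1, c s ∈ closedBall x (κ * ν' / TowerRates.tuned.N 0)) ∧
      (∀ s ∈ Icc (0 : ℝ) 1, ‖deriv c s‖ ≤ 8 * Real.pi * (κ * ν') / TowerRates.tuned.N 0) ∧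
      ν' * TowerRates.tuned.N 0 ^ (TowerRates.tuned.β - 2) ≤ circulation (v t_a) c)
    (hanchor : ∀ x, κ * ‖v t_a x‖ = TowerRates.tuned.Y 0 → 0 < ⟪v t_a x, accel ν' (v t_a) x⟫)
    (hE : ∃ C : ℝ≥0∞, C < ⊤ ∧ ∀ t ∈ Icc t_a (t_a + T), ∫⁻ x, ‖v t x‖ₑ ^ 2 ≤ C)
    {η : ℝ} (hη : 0 < η)
    (hcap : ∀ t ∈ Icc t_a (t_a + T), ∀ x, κ * ‖v t x‖ ≤ 5 / 3 * TowerRates.tuned.Y 1 - η)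
    (hspeed : ∃ x, ‖x - x₀‖ ≤ ρ ∧ TowerRates.tuned.Y 1 + η ≤ κ * ‖v (t_a + T) x‖)
    (hstrain : ∃ x, ‖x - x₀‖ ≤ ρ ∧ TowerRates.tuned.A 1 + η ≤ κ ^ 2 * ν' * ‖fderiv ℝ (v (t_a + T)) x‖)
    (hcore : ∃ (x : EuclideanSpace ℝ (Fin 3)) (c : ℝ → EuclideanSpace ℝ (Fin 3)),
      ‖x - x₀‖ ≤ ρ ∧ ContDiff ℝ 1 c ∧ c 0 = c 1 ∧
      (∀ s ∈ Icc (0 : ℝ) 1, c s ∈ closedBall x (κ * ν' / TowerRates.tuned.N 1)) ∧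
      (∀ s ∈ Icc (0 : ℝ) 1, ‖deriv c s‖ ≤ 8 * Real.pi * (κ * ν') / TowerRates.tuned.N 1) ∧
      ν' * (TowerRates.tuned.N 1 ^ (TowerRates.tuned.β - 2) + η) ≤ circulation (v (t_a + T)) c) :
    PalasekTowerBreakdown.EpisodeBaseT ∧
      ¬ (PalasekTowerBreakdown.HeredityAtOneT ∧ PalasekTowerBreakdown.HeredityFromTwoT) := by
  have hW : NoSwirlRungAtOneT :=
    palasekTowerBreakdown_noSwirlRungGAt_one_of_scaled_sterile_freeRun TowerRates.tuned_boxNumerics hν' hκ t_a hx0 hx1 hT hv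
      hsupp hax hsw hceil hfloor hstrain₀ hcore₀ hanchor hE hη hcap hspeed hstrain hcore
  refine ⟨?_, fun hp => not_noSwirlRungAtOneT_of_heredity_pair hp.1 hp.2 hW⟩
  obtain ⟨S, hP, hRg, hQ, -, hs⟩ := hW
  exact ⟨S, hP, hRg, hQ, hs⟩

end Summit.NavierStokesRegularity.NavierStokesRegularity.Theorems

end
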